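import Mathlib
import HarnessLib
import Literature.NumberTheory.Transcendental.KZCalculus
import Literature.NumberTheory.Transcendental.KZProduct
import Literature.NumberTheory.Transcendental.SemialgebraicMaps
import Summits.KontsevichZagierPeriods.KontsevichZagierPeriods.Theses.LinRedNormalForm
import Summits.KontsevichZagierPeriods.KontsevichZagierPeriods.Theorems.LinRedNormalFormDihedralNormalFormStubAtomReduction
import Summits.KontsevichZagierPeriods.KontsevichZagierPeriods.Theorems.LinRedNormalFormDihedralNormalFormStubBvStokes
import Summits.KontsevichZagierPeriods.KontsevichZagierPeriods.Theorems.LinRedNormalFormDihedralNormalFormStubBoundedStokesMove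
import Summits.KontsevichZagierPeriods.KontsevichZagierPeriods.Theorems.LinRedNormalFormDihedralNormalFormStubProductClosure
import Summits.KontsevichZagierPeriods.KontsevichZagierPeriods.Theorems.LinRedNormalFormDihedralNormalFormStubExactToFacesOne
import Summits.KontsevichZagierPeriods.KontsevichZagierPeriods.Theorems.LinRedNormalFormDihedralNormalFormStubExactToFacesTwo
import Summits.KontsevichZagierPeriods.KontsevichZagierPeriods.Theorems.LinRedNormalFormDihedralNormalFormStubCellZetaMovesLow

/-!
# Line `tame-bv-stokes` — skeleton for crux `DihedralNormalForm` (stmt-KontsevichZagierPeriods-3912)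

Second-lineage lead's skeleton of line `tame-bv-stokes` (planner
`planner-cruxplan-stmt-KontsevichZagierPeriods-391-tame-bv-stokes-0`, planner skeleton sha
`522d64ac0fe6`), REBUILT by the lead from the six stub signatures archived on the crux item (the
planner's `Lines/tame-bv-stokes.lean` was never published under `Cruxes/DihedralNormalForm/Lines/`
and the gate evidence store is not mounted in the lead's jail). Three stubs verbatim from the
planner (`stub_bvStokes`, `stub_boundedStokesMove`, `stub_productClosure`), the planner's
`stub_cellZetaMoves` RESHAPED by dimension into `stub_cellZetaMovesLow` (`ℓ ≤ 2`),
`stub_cellZetaMovesThree` (`ℓ = 3`) and `stub_cellZetaMovesVeryHigh` (`ℓ ≥ 4`),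
the planner's `stub_exactToFaces` RESHAPED by dimension into `stub_exactToFacesOne` (dimension 1),
`stub_exactToFacesTwo` (dimension 2) and `stub_exactToFacesHigh` (dimension ≥ 3); the ENTRANCE stub `stub_atomReduction` is taken with the signature
registered by the FIRST lineage (line `torus-descent-sum-shadow`, ℕ-exponent cubical atoms), so
that one proof serves both lines; the composition `DihedralNormalForm_of` is sorry-free.

## Objects

* `WordRep` — the crux's target generators: MZV word representations `[Δ_w, q · ∏ ω_{εᵢ}(tᵢ)]`.
* `CubRep k` — cubical representations `[□ᵏ, q · xᵃ · ∏_{i ≤ j} (1 − x_i ⋯ x_j)^{e i j}]` on the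
  OPEN unit cube, `a ∈ ℤᵏ`, `e ∈ ℤ` (absolutely convergent: they are `KZ.IntegralRep`s);
  `AtomN k` — the same with `a ∈ ℕᵏ` (the first lineage's atoms; `AtomN k ⊆ CubRep k`).
* `LogRep ℓ` — representations on the open ordered simplex `Δ_ℓ` whose integrand is a
  `ℚ`-combination of bar/Arnold products `∏ᵢ (tᵢ − aᵢ)⁻¹`, `aᵢ ∈ {0, 1, t₀, …, t_{i−1}}`
  (convergent combinations of top-degree logarithmic forms of `M_{0,ℓ+3}` restricted to the cell).

## The chain

`stub_atomReduction : crux input ↦ closure (AtomN k) ⊆ closure (CubRep k)` (cubical chart, rule 2;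
Brown's convergence lemma, rule 1b) ·
`stub_bvStokes` (o-minimal bounded variation: a bounded `ℚ`-semialgebraic function differentiable
on the open cube has absolutely integrable coordinate derivatives) ·
`stub_boundedStokesMove` (Stokes on the open cube for `Σᵢ ∂ᵢ hᵢ` with bounded semialgebraic `hᵢ`
continuous on closed fibres = `(k+1)` reindexings + `(k+1)` Newton–Leibniz moves + integrand
additivity) ·
`stub_exactToFacesOne : CubRep 1 ↦ relations ⊔ closure (CubRep 0)` (one Newton–Leibniz move with a
polynomial primitive) · `stub_exactToFacesTwo : CubRep 2 ↦ relations ⊔ closure (LogRep 2 ∪ CubRep 1)` (explicit integration by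
parts with bounded primitives) · `stub_exactToFacesHigh : CubRep (ℓ+3) ↦ relations ⊔ closure (LogRep (ℓ+3) ∪
CubRep (ℓ+2))` (algebraic de
Rham reduction on Brown's `M^δ`: an atom minus its projection to the convergent log forms is `d` of
a form with BOUNDED regular coefficients, whose Stokes chain is legal by the previous stub and whose
face terms are cubical representations one dimension down) ·
`stub_cellZetaMovesLow : LogRep ℓ ↦ relations ⊔ closure WordRep, ℓ ≤ 2` (residues) ·
`stub_cellZetaMovesThree : LogRep 3 ↦ relations ⊔ closure WordRep` (residues + the order-6 rotation of M_{0,6}) ·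
`stub_cellZetaMovesVeryHigh : LogRep (ℓ+4) ↦ relations ⊔ closure (WordRep ∪ products of lower LogRep)` (the
word-surjectivity half of the Brown–Carr–Schneps cell-zeta picture: dihedral relabellings = rule 2,
product maps = shuffle dissections, polygon identities = rule 1b) ·
`stub_productClosure` (`relations ⊔ closure WordRep` is closed under `IntegralRep.prod`: ideal
property of `relations` + the shuffle dissection of a product of simplices).
Composition: strong induction on the dimension `ℓ` (`CubRep 0 ⊆ WordRep` are the constants).
-/

noncomputable section

set_option linter.dupNamespace false

open MeasureTheory Set

namespace Summit.KontsevichZagierPeriods.KontsevichZagierPeriods.Cruxes.DihedralNormalForm.TameBVStokes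

open Literature.NumberTheory.Transcendental
open Summit.KontsevichZagierPeriods.KontsevichZagierPeriods.Theses.LinRedNormalForm (DihedralNormalForm)

/-! ## The generator sets -/

/-- The crux's target generators: MZV word representations `[Δ_w, q · ∏ ω_{εᵢ}(tᵢ)]`. -/
abbrev WordRep : Set KZ.FormalRep :=
  {x : Literature.NumberTheory.Transcendental.KZ.FormalRep | ∃ (w : ℕ) (ε : Fin w → Bool) (q : ℚ) (s : Literature.NumberTheory.Transcendental.KZ.IntegralRep w), s.domain = {t : Fin w → ℝ | (∀ i, 0 < t i) ∧ (∀ i, t i < 1) ∧ StrictAnti t} ∧ Set.EqOn s.integrand (fun t => (q : ℝ) * ∏ i, if ε i then 1 / (1 - t i) else 1 / t i) s.domain ∧ x = Literature.NumberTheory.Transcendental.KZ.of s}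

/-- Cubical representations of dimension `k` with integer exponents (module docstring). -/
abbrev CubRep (k : ℕ) : Set KZ.FormalRep :=
  {y : Literature.NumberTheory.Transcendental.KZ.FormalRep | ∃ (q : ℚ) (a : Fin k → ℤ) (e : Fin k → Fin k → ℤ) (s : Literature.NumberTheory.Transcendental.KZ.IntegralRep k), s.domain = {x : Fin k → ℝ | ∀ i, x i ∈ Set.Ioo (0:ℝ) 1} ∧ Set.EqOn s.integrand (fun x => (q : ℝ) * ((∏ i, x i ^ a i) * ∏ i, ∏ j, if i ≤ j then (1 - ∏ l, if i ≤ l ∧ l ≤ j then x l else 1) ^ e i j else 1)) s.domain ∧ y = Literature.NumberTheory.Transcendental.KZ.of s}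

/-- The first lineage's cubical ATOMS (natural-number exponents). -/
abbrev AtomN (k : ℕ) : Set KZ.FormalRep :=
  {z : Literature.NumberTheory.Transcendental.KZ.FormalRep | ∃ (q : ℚ) (a : Fin k → ℕ) (e : Fin k → Fin k → ℤ) (s : Literature.NumberTheory.Transcendental.KZ.IntegralRep k), s.domain = {x : Fin k → ℝ | ∀ i, x i ∈ Set.Ioo (0:ℝ) 1} ∧ Set.EqOn s.integrand (fun x => (q : ℝ) * ((∏ i : Fin k, x i ^ a i) * ∏ i : Fin k, ∏ j : Fin k, if i ≤ j then (1 - (∏ l : Fin k, if i ≤ l ∧ l ≤ j then x l else 1)) ^ e i j else 1)) s.domain ∧ z = Literature.NumberTheory.Transcendental.KZ.of s}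

/-- Convergent `ℚ`-combinations of bar/Arnold products on the open ordered simplex `Δ_ℓ`. -/
abbrev LogRep (ℓ : ℕ) : Set KZ.FormalRep :=
  {y : Literature.NumberTheory.Transcendental.KZ.FormalRep | ∃ (q : (Fin ℓ → Fin (ℓ + 2)) → ℚ) (s : Literature.NumberTheory.Transcendental.KZ.IntegralRep ℓ), s.domain = {t : Fin ℓ → ℝ | (∀ i, 0 < t i) ∧ (∀ i, t i < 1) ∧ StrictAnti t} ∧ Set.EqOn s.integrand (fun t => ∑ f : Fin ℓ → Fin (ℓ + 2), (q f : ℝ) * ∏ i : Fin ℓ, 1 / (t i - (if ((f i : Fin (ℓ + 2)) : ℕ) = 0 then (0:ℝ) else if ((f i : Fin (ℓ + 2)) : ℕ) = 1 then 1 else if h : ((f i : Fin (ℓ + 2)) : ℕ) - 2 < (i : ℕ) then t ⟨((f i : Fin (ℓ + 2)) : ℕ) - 2, lt_trans h i.isLt⟩ else 0))) s.domain ∧ y = Literature.NumberTheory.Transcendental.KZ.of s}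

/-! ## The six stubs (signatures verbatim as registered) -/

/-- **stub_atomReduction** (LANDED by lineage a, `Theorems/LinRedNormalFormDihedralNormalFormStubAtomReduction.lean`; SHARED with line `torus-descent-sum-shadow`). ENTRANCE: the cubical chart `tᵢ = x₀ x₁ ⋯ xᵢ` (rule 2, polynomial map, injective on the open cube, Jacobian `∏ xᵢ^{k-1-i}`, image the open ordered simplex) carries a genus-zero representation to the open cube, where the integrand is `P(x)·x^{-B}·∏(1 - x_I)^{-e_I}` over interval chords `I`; Brown's convergence lemma (ENS 2009, §7: absolute convergence forces the dihedral-coordinate expansion to be polynomial) splits it into a `ℚ`-combination of CONVERGENT atoms (rule 1b, every term convergent). -/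
theorem stub_atomReduction : ∀ (k : ℕ) (r : Literature.NumberTheory.Transcendental.KZ.IntegralRep k) (p : MvPolynomial (Fin k) ℚ) (a : Fin k → Fin k → ℕ) (b c : Fin k → ℕ), r.domain = {t | (∀ i, 0 < t i) ∧ (∀ i, t i < 1) ∧ StrictAnti t} → Set.EqOn r.integrand (fun t => MvPolynomial.aeval t p / ((∏ i, t i ^ b i) * (∏ i, (1 - t i) ^ c i) * ∏ i, ∏ j, if i < j then (t i - t j) ^ a i j else 1)) r.domain → ∃ m ∈ AddSubgroup.closure {z : Literature.NumberTheory.Transcendental.KZ.FormalRep | ∃ (q : ℚ) (a : Fin k → ℕ) (e : Fin k → Fin k → ℤ) (s : Literature.NumberTheory.Transcendental.KZ.IntegralRep k), s.domain = {x : Fin k → ℝ | ∀ i, x i ∈ Set.Ioo (0:ℝ) 1} ∧ Set.EqOn s.integrand (fun x => (q : ℝ) * ((∏ i : Fin k, x i ^ a i) * ∏ i : Fin k, ∏ j : Fin k, if i ≤ j then (1 - (∏ l : Fin k, if i ≤ l ∧ l ≤ j then x l else 1)) ^ e i j else 1)) s.domain ∧ z = Literature.NumberTheory.Transcendental.KZ.of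 s}, Literature.NumberTheory.Transcendental.KZ.of r - m ∈ Literature.NumberTheory.Transcendental.KZ.relations :=
  Summit.KontsevichZagierPeriods.DihedralNormalForm.TorusDescent.stub_atomReduction

/-- **stub_bvStokes** (LANDED p81496, `Theorems/LinRedNormalFormDihedralNormalFormStubBvStokes.lean`). TAME BOUNDED VARIATION: a `ℚ`-semialgebraic `h`, bounded by `C` and differentiable on the open cube, has absolutely integrable `i`-th partial derivative. Fibrewise in the coordinate `i`: `∂ᵢh` is semialgebraic (`IsSemialgebraicFunOn.fderiv_apply_single`), the frontier points of the fibres of `{∂ᵢh > 0}`, `{∂ᵢh < 0}` form a semialgebraic family of finite sets, hence of uniformly bounded size `N` (`IsSemialgebraic.exists_forall_encard_fibre_le`); on each of the `≤ 2N+1` complementary intervals `t ↦ h` is monotone, so `∫ |∂ₜ h| ≤ 2C` there (`intervalIntegral.integrableOn_deriv_of_nonneg`, FTC); Tonelli along `MeasurableEquiv.piFinSuccAbove _ i`. -/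
theorem stub_bvStokes : ∀ (k : ℕ) (i : Fin (k + 1)) (h : (Fin (k + 1) → ℝ) → ℝ) (C : ℝ), Literature.NumberTheory.Transcendental.IsSemialgebraicFunOn ℚ {x : Fin (k + 1) → ℝ | ∀ i, x i ∈ Set.Ioo (0:ℝ) 1} h → (∀ x ∈ {x : Fin (k + 1) → ℝ | ∀ i, x i ∈ Set.Ioo (0:ℝ) 1}, |h x| ≤ C) → (∀ x ∈ {x : Fin (k + 1) → ℝ | ∀ i, x i ∈ Set.Ioo (0:ℝ) 1}, DifferentiableAt ℝ h x) → MeasureTheory.IntegrableOn (fun x => fderiv ℝ h x (Pi.single i 1)) {x : Fin (k + 1) → ℝ | ∀ i, x i ∈ Set.Ioo (0:ℝ) 1} :=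
  Summit.KontsevichZagierPeriods.DihedralNormalForm.TameBVStokes.stub_bvStokes

/-- **stub_boundedStokesMove** (LANDED p83556, `Theorems/LinRedNormalFormDihedralNormalFormStubBoundedStokesMove.lean`). STOKES ON THE OPEN CUBE AS MOVES: for bounded `ℚ`-semialgebraic `hᵢ` (semialgebraic on the closed cube, differentiable inside, continuous on each closed `i`-fibre) the representation of `Σᵢ ∂ᵢhᵢ` on the open cube minus `Σᵢ ([□ᵏ, hᵢ|_{xᵢ=1}] − [□ᵏ, hᵢ|_{xᵢ=0}])` is a relation: integrand additivity (rule 1b; each `∂ᵢhᵢ` is integrable by the BV hypothesis and semialgebraic by `IsSemialgebraicFunOn.fderiv_apply_single`), then for each `i` the reindexing moving coordinate `i` last (`KZ.of_sub_of_reindex_mem_relations`, rule 2), closed versus open fibres (`KZ.of_sub_of_restrict_openBand_mem_relations`), ONE Newton–Leibniz move with primitive `hᵢ` itself (rule 3, base `□ᵏ`, `a = 0`, `b = 1`), and integrand additivity on the base. -/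
theorem stub_boundedStokesMove : (∀ (k : ℕ) (i : Fin (k + 1)) (h : (Fin (k + 1) → ℝ) → ℝ) (C : ℝ), Literature.NumberTheory.Transcendental.IsSemialgebraicFunOn ℚ {x : Fin (k + 1) → ℝ | ∀ i, x i ∈ Set.Ioo (0:ℝ) 1} h → (∀ x ∈ {x : Fin (k + 1) → ℝ | ∀ i, x i ∈ Set.Ioo (0:ℝ) 1}, |h x| ≤ C) → (∀ x ∈ {x : Fin (k + 1) → ℝ | ∀ i, x i ∈ Set.Ioo (0:ℝ) 1}, DifferentiableAt ℝ h x) → MeasureTheory.IntegrableOn (fun x => fderiv ℝ h x (Pi.single i 1)) {x : Fin (k + 1) → ℝ | ∀ i, x i ∈ Set.Ioo (0:ℝ) 1}) → ∀ (k : ℕ) (h : Fin (k + 1) → (Fin (k + 1) → ℝ) → ℝ) (C : ℝ) (r : Literature.NumberTheory.Transcendental.KZ.IntegralRep (k + 1)) (f₀ f₁ : Fin (k + 1) → Literature.NumberTheory.Transcendental.KZ.IntegralRep k), (∀ i, Literature.NumberTheory.Transcendental.IsSemialgebraicFunOn ℚ {x : Fin (k + 1) → ℝ | ∀ i, x i ∈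 Set.Icc (0:ℝ) 1} (h i)) → (∀ i, ∀ x ∈ {x : Fin (k + 1) → ℝ | ∀ i, x i ∈ Set.Ioo (0:ℝ) 1}, |h i x| ≤ C) → (∀ i, ∀ x ∈ {x : Fin (k + 1) → ℝ | ∀ i, x i ∈ Set.Ioo (0:ℝ) 1}, DifferentiableAt ℝ (h i) x) → (∀ i, ∀ y ∈ {x : Fin k → ℝ | ∀ i, x i ∈ Set.Ioo (0:ℝ) 1}, ContinuousOn (fun t : ℝ => h i (Fin.insertNth i t y)) (Set.Icc 0 1)) → r.domain = {x : Fin (k + 1) → ℝ | ∀ i, x i ∈ Set.Ioo (0:ℝ) 1} → Set.EqOn r.integrand (fun x => ∑ i, fderiv ℝ (h i) x (Pi.single i 1)) r.domain → (∀ i, (f₀ i).domain = {x : Fin k → ℝ | ∀ i, x i ∈ Set.Ioo (0:ℝ) 1} ∧ (f₁ i).domain = {x : Fin k → ℝ | ∀ i, x i ∈ Set.Ioo (0:ℝ) 1} ∧ Set.EqOn (f₀ i).integrand (fun y => h i (Fin.insertNth i 0 y)) {x : Fin k → ℝ | ∀ i, x i ∈ Set.Ioo (0:ℝ) 1} ∧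 Set.EqOn (f₁ i).integrand (fun y => h i (Fin.insertNth i 1 y)) {x : Fin k → ℝ | ∀ i, x i ∈ Set.Ioo (0:ℝ) 1}) → Literature.NumberTheory.Transcendental.KZ.of r - ∑ i, (Literature.NumberTheory.Transcendental.KZ.of (f₁ i) - Literature.NumberTheory.Transcendental.KZ.of (f₀ i)) ∈ Literature.NumberTheory.Transcendental.KZ.relations :=
  Summit.KontsevichZagierPeriods.DihedralNormalForm.TameBVStokes.stub_boundedStokesMove

/-- **stub_exactToFacesOne** (LANDED p87141, `Theorems/LinRedNormalFormDihedralNormalFormStubExactToFacesOne.lean`). DIMENSION ONE: a convergent cubical representation `[(0,1), q·x^a·(1-x)^e]` has `a ≥ 0` and `e ≥ 0` (absolute convergence at the two endpoints), so ONE Newton–Leibniz move with the polynomial primitive `F(x) = q ∫₀ˣ t^a (1-t)^e dt` (rule 3 over the one-point base, `a = 0`, `b = 1`; closed versus open interval is a null set, rule 1a) lands on the constant `[pt, F(1)]`, a cubical representation of dimension `0`. -/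
theorem stub_exactToFacesOne (CubRep : ℕ → Set Literature.NumberTheory.Transcendental.KZ.FormalRep) (hCubRep : ∀ k, CubRep k = {y : Literature.NumberTheory.Transcendental.KZ.FormalRep | ∃ (q : ℚ) (a : Fin k → ℤ) (e : Fin k → Fin k → ℤ) (s : Literature.NumberTheory.Transcendental.KZ.IntegralRep k), s.domain = {x : Fin k → ℝ | ∀ i, x i ∈ Set.Ioo (0:ℝ) 1} ∧ Set.EqOn s.integrand (fun x => (q : ℝ) * ((∏ i, x i ^ a i) * ∏ i, ∏ j, if i ≤ j then (1 - ∏ l, if i ≤ l ∧ l ≤ j then x l else 1) ^ e i j else 1)) s.domain ∧ y = Literature.NumberTheory.Transcendental.KZ.of s}) : ∀ y ∈ CubRep 1, y ∈ Literature.NumberTheory.Transcendental.KZ.relations ⊔ AddSubgroup.closure (CubRep 0) :=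
  Summit.KontsevichZagierPeriods.DihedralNormalForm.TameBVStokes.stub_exactToFacesOne CubRep hCubRep

/-- **stub_exactToFacesTwo** (LANDED p94661 + Aux p92042/p93774/p92047/p94396, `Theorems/LinRedNormalFormDihedralNormalFormStubExactToFacesTwo*.lean`). DIMENSION TWO, explicit: a convergent `[□², q·x^a y^b (1−x)^P (1−y)^R (1−xy)^{−s}]` has `a,b,P,R ≥ 0` and `s ≤ P+R+1`; (i) `s ≤ 0`: polynomial, one Newton–Leibniz move in `y` with polynomial primitive, the base `[□¹, poly]` splits into monomial atoms; (ii) `s ≥ 2` (with `b ≥ 1`, symmetrically `a ≥ 1`, and `1 = (1−xy) + xy` when `a = b = 0`): the bounded Stokes move with `h = q x^a y^{b−1}(1−x)^P(1−y)^R(1−xy)^{1−s}/(s−1)` (bounded BECAUSE `P+R ≥ s−1`), whose `∂ₓ` is the atom plus two atoms of pole order `s−1` and whose faces are polynomials; (iii) `s = 1`: binomial expansion, `x^a y^b/(1−xy) = x^{a−b}/(1−xy) − Σ_{j<b} x^{a−b}(xy)^j` (`a ≥ b`), and for `T_c = x^c/(1−xy)`, `c ≥ 1`, the bounded primitives `A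 = −(q/c)x^c(1−x)/(1−xy)`, `B = −(q/c)x^{c−1}(1−y)/(1−xy)` give `∂ₓA + ∂_yB = (q/c)(cT_c + (1−c)T_{c−1})`; finally `T_0 = 1/(1−xy)` is carried by the chart `(t₀,t₁) = (x, xy)` (rule 2, Jacobian `x`) onto `[Δ₂, −1/((t₀−0)(t₁−1))] ∈ LogRep 2`. -/
theorem stub_exactToFacesTwo (CubRep : ℕ → Set Literature.NumberTheory.Transcendental.KZ.FormalRep) (hCubRep : ∀ k, CubRep k = {y : Literature.NumberTheory.Transcendental.KZ.FormalRep | ∃ (q : ℚ) (a : Fin k → ℤ) (e : Fin k → Fin k → ℤ) (s : Literature.NumberTheory.Transcendental.KZ.IntegralRep k), s.domain = {x : Fin k → ℝ | ∀ i, x i ∈ Set.Ioo (0:ℝ) 1} ∧ Set.EqOn s.integrand (fun x => (q : ℝ) * ((∏ i, x i ^ a i) * ∏ i, ∏ j, if i ≤ j then (1 - ∏ l, if i ≤ l ∧ l ≤ j then x l else 1) ^ e i j else 1)) s.domain ∧ y = Literature.NumberTheory.Transcendental.KZ.of s}) (LogRep : ℕ → Set Literature.NumberTheory.Transcendental.KZ.FormalRep)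 (hLogRep : ∀ ℓ, LogRep ℓ = {y : Literature.NumberTheory.Transcendental.KZ.FormalRep | ∃ (q : (Fin ℓ → Fin (ℓ + 2)) → ℚ) (s : Literature.NumberTheory.Transcendental.KZ.IntegralRep ℓ), s.domain = {t : Fin ℓ → ℝ | (∀ i, 0 < t i) ∧ (∀ i, t i < 1) ∧ StrictAnti t} ∧ Set.EqOn s.integrand (fun t => ∑ f : Fin ℓ → Fin (ℓ + 2), (q f : ℝ) * ∏ i : Fin ℓ, 1 / (t i - (if ((f i : Fin (ℓ + 2)) : ℕ) = 0 then (0:ℝ) else if ((f i : Fin (ℓ + 2)) : ℕ) = 1 then 1 else if h : ((f i : Fin (ℓ + 2)) : ℕ) - 2 < (i : ℕ) then t ⟨((f i : Fin (ℓ + 2)) : ℕ) - 2, lt_trans h i.isLt⟩ else 0))) s.domain ∧ y = Literature.NumberTheory.Transcendental.KZ.of s}) : (∀ (k : ℕ) (h : Fin (k + 1) → (Fin (k + 1) → ℝ) → ℝ) (C : ℝ) (r : Literature.NumberTheory.Transcendental.KZ.IntegralRep (k + 1)) (f₀ f₁ : Fin (k + 1) → Literature.NumberTheory.Transcendental.KZ.IntegralRep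 k), (∀ i, Literature.NumberTheory.Transcendental.IsSemialgebraicFunOn ℚ {x : Fin (k + 1) → ℝ | ∀ i, x i ∈ Set.Icc (0:ℝ) 1} (h i)) → (∀ i, ∀ x ∈ {x : Fin (k + 1) → ℝ | ∀ i, x i ∈ Set.Ioo (0:ℝ) 1}, |h i x| ≤ C) → (∀ i, ∀ x ∈ {x : Fin (k + 1) → ℝ | ∀ i, x i ∈ Set.Ioo (0:ℝ) 1}, DifferentiableAt ℝ (h i) x) → (∀ i, ∀ y ∈ {x : Fin k → ℝ | ∀ i, x i ∈ Set.Ioo (0:ℝ) 1}, ContinuousOn (fun t : ℝ => h i (Fin.insertNth i t y)) (Set.Icc 0 1)) → r.domain = {x : Fin (k + 1) → ℝ | ∀ i, x i ∈ Set.Ioo (0:ℝ) 1} → Set.EqOn r.integrand (fun x => ∑ i, fderiv ℝ (h i) x (Pi.single i 1)) r.domain → (∀ i, (f₀ i).domain = {x : Fin k → ℝ | ∀ i, x i ∈ Set.Ioo (0:ℝ) 1} ∧ (f₁ i).domain = {x : Fin k → ℝ | ∀ i, x i ∈ Set.Ioo (0:ℝ) 1} ∧ Set.EqOn (f₀ i).integrand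 (fun y => h i (Fin.insertNth i 0 y)) {x : Fin k → ℝ | ∀ i, x i ∈ Set.Ioo (0:ℝ) 1} ∧ Set.EqOn (f₁ i).integrand (fun y => h i (Fin.insertNth i 1 y)) {x : Fin k → ℝ | ∀ i, x i ∈ Set.Ioo (0:ℝ) 1}) → Literature.NumberTheory.Transcendental.KZ.of r - ∑ i, (Literature.NumberTheory.Transcendental.KZ.of (f₁ i) - Literature.NumberTheory.Transcendental.KZ.of (f₀ i)) ∈ Literature.NumberTheory.Transcendental.KZ.relations) → ∀ y ∈ CubRep 2, y ∈ Literature.NumberTheory.Transcendental.KZ.relations ⊔ AddSubgroup.closure (LogRep 2 ∪ CubRep 1) :=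
  Summit.KontsevichZagierPeriods.DihedralNormalForm.TameBVStokes.stub_exactToFacesTwo CubRep hCubRep LogRep hLogRep

/-- **stub_exactToFacesHigh** (XL, research-sized). DE RHAM REDUCTION ON `M^δ`, dimension `≥ 3`: modulo the bounded Stokes move, every cubical representation of dimension `ℓ+3` is a `ℤ`-combination of convergent bar-form representations on `Δ_{ℓ+3}` (inverse cubical chart, rule 2) and of cubical representations of dimension `ℓ+2` (face terms): the class of a convergent atom in `H^{ℓ+3}(M^δ_{0,ℓ+6})` is represented by convergent logarithmic forms (Brown–Carr–Schneps 2010, Thm 4.9) and the difference is `d` of a form with coefficients regular on `M^δ`, i.e. BOUNDED on the closed cell, chart by chart (Brown ENS 2009, Prop. 2.22, Lemma 2.24, Lemma 7.4); in one cubical chart integration by parts on a chord raises the orders of the other chords through the same variable, so Brown's vertex charts (rule 2 between charts, rule 1a for the chart partition) are needed from dimension 3 on. -/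
theorem stub_exactToFacesHigh (CubRep : ℕ → Set Literature.NumberTheory.Transcendental.KZ.FormalRep) (hCubRep : ∀ k, CubRep k = {y : Literature.NumberTheory.Transcendental.KZ.FormalRep | ∃ (q : ℚ) (a : Fin k → ℤ) (e : Fin k → Fin k → ℤ) (s : Literature.NumberTheory.Transcendental.KZ.IntegralRep k), s.domain = {x : Fin k → ℝ | ∀ i, x i ∈ Set.Ioo (0:ℝ) 1} ∧ Set.EqOn s.integrand (fun x => (q : ℝ) * ((∏ i, x i ^ a i) * ∏ i, ∏ j, if i ≤ j then (1 - ∏ l, if i ≤ l ∧ l ≤ j then x l else 1) ^ e i j else 1)) s.domain ∧ y = Literature.NumberTheory.Transcendental.KZ.of s}) (LogRep : ℕ → Set Literature.NumberTheory.Transcendental.KZ.FormalRep) (hLogRep : ∀ ℓ, LogRep ℓ = {y : Literature.NumberTheory.Transcendental.KZ.FormalRep | ∃ (q : (Fin ℓ → Fin (ℓ + 2)) → ℚ) (s : Literature.NumberTheory.Transcendental.KZ.IntegralRep ℓ), s.domain = {t : Fin ℓ → ℝ | (∀ i, 0 < t i) ∧ (∀ i, t i < 1) ∧ StrictAnti t}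 ∧ Set.EqOn s.integrand (fun t => ∑ f : Fin ℓ → Fin (ℓ + 2), (q f : ℝ) * ∏ i : Fin ℓ, 1 / (t i - (if ((f i : Fin (ℓ + 2)) : ℕ) = 0 then (0:ℝ) else if ((f i : Fin (ℓ + 2)) : ℕ) = 1 then 1 else if h : ((f i : Fin (ℓ + 2)) : ℕ) - 2 < (i : ℕ) then t ⟨((f i : Fin (ℓ + 2)) : ℕ) - 2, lt_trans h i.isLt⟩ else 0))) s.domain ∧ y = Literature.NumberTheory.Transcendental.KZ.of s}) : (∀ (k : ℕ) (h : Fin (k + 1) → (Fin (k + 1) → ℝ) → ℝ) (C : ℝ) (r : Literature.NumberTheory.Transcendental.KZ.IntegralRep (k + 1)) (f₀ f₁ : Fin (k + 1) → Literature.NumberTheory.Transcendental.KZ.IntegralRep k), (∀ i, Literature.NumberTheory.Transcendental.IsSemialgebraicFunOn ℚ {x : Fin (k + 1) → ℝ | ∀ i, x i ∈ Set.Icc (0:ℝ) 1} (h i)) → (∀ i, ∀ x ∈ {x : Fin (k + 1) → ℝ | ∀ i, x i ∈ Set.Ioo (0:ℝ) 1}, |h i x| ≤ C) → (∀ i, ∀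 x ∈ {x : Fin (k + 1) → ℝ | ∀ i, x i ∈ Set.Ioo (0:ℝ) 1}, DifferentiableAt ℝ (h i) x) → (∀ i, ∀ y ∈ {x : Fin k → ℝ | ∀ i, x i ∈ Set.Ioo (0:ℝ) 1}, ContinuousOn (fun t : ℝ => h i (Fin.insertNth i t y)) (Set.Icc 0 1)) → r.domain = {x : Fin (k + 1) → ℝ | ∀ i, x i ∈ Set.Ioo (0:ℝ) 1} → Set.EqOn r.integrand (fun x => ∑ i, fderiv ℝ (h i) x (Pi.single i 1)) r.domain → (∀ i, (f₀ i).domain = {x : Fin k → ℝ | ∀ i, x i ∈ Set.Ioo (0:ℝ) 1} ∧ (f₁ i).domain = {x : Fin k → ℝ | ∀ i, x i ∈ Set.Ioo (0:ℝ) 1} ∧ Set.EqOn (f₀ i).integrand (fun y => h i (Fin.insertNth i 0 y)) {x : Fin k → ℝ | ∀ i, x i ∈ Set.Ioo (0:ℝ) 1} ∧ Set.EqOn (f₁ i).integrand (fun y => h i (Fin.insertNth i 1 y)) {x : Fin k → ℝ | ∀ i, x i ∈ Set.Ioo (0:ℝ) 1}) → Literature.NumberTheory.Transcendental.KZ.of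 r - ∑ i, (Literature.NumberTheory.Transcendental.KZ.of (f₁ i) - Literature.NumberTheory.Transcendental.KZ.of (f₀ i)) ∈ Literature.NumberTheory.Transcendental.KZ.relations) → ∀ (ℓ : ℕ), ∀ y ∈ CubRep (ℓ + 3), y ∈ Literature.NumberTheory.Transcendental.KZ.relations ⊔ AddSubgroup.closure (LogRep (ℓ + 3) ∪ CubRep (ℓ + 2)) := by
  sorry

/-- **stub_cellZetaMovesLow** (LANDED p96167 + Aux1 p95433, `Theorems/LinRedNormalFormDihedralNormalFormStubCellZetaMovesLow*.lean`). LOW DIMENSIONS `ℓ ≤ 2` of word surjectivity, by residues: for `ℓ = 0` a convergent bar-form combination is a rational constant = the empty word; for `ℓ = 1` the integrand `c₀/t + c₁/(t−1)` is integrable on `(0,1)` only if `c₀ = c₁ = 0` (zero representation, a relation); for `ℓ = 2` the six Arnold forms `1/((t₀−a)(t₁−b))`, `a ∈ {0,1}`, `b ∈ {0,1,t₀}`, have independent residues along `t₁ = 0`, `t₀ = 1`, `t₀ = t₁`, so an integrable combination on `{1 > t₀ > t₁ > 0}` is `c/(t₀(t₁−1))`, which IS the `ζ(2)` word representation with coefficient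 `−c` (Brown–Carr–Schneps 2010, §4.4: `dim H²(M^δ_{0,5}) = 1`). -/
theorem stub_cellZetaMovesLow (LogRep : ℕ → Set Literature.NumberTheory.Transcendental.KZ.FormalRep) (hLogRep : ∀ ℓ, LogRep ℓ = {y : Literature.NumberTheory.Transcendental.KZ.FormalRep | ∃ (q : (Fin ℓ → Fin (ℓ + 2)) → ℚ) (s : Literature.NumberTheory.Transcendental.KZ.IntegralRep ℓ), s.domain = {t : Fin ℓ → ℝ | (∀ i, 0 < t i) ∧ (∀ i, t i < 1) ∧ StrictAnti t} ∧ Set.EqOn s.integrand (fun t => ∑ f : Fin ℓ → Fin (ℓ + 2), (q f : ℝ) * ∏ i : Fin ℓ, 1 / (t i - (if ((f i : Fin (ℓ + 2)) : ℕ) = 0 then (0:ℝ) else if ((f i : Fin (ℓ + 2)) : ℕ) = 1 then 1 else if h : ((f i : Fin (ℓ + 2)) : ℕ) - 2 < (i : ℕ) then t ⟨((f i : Fin (ℓ + 2)) : ℕ) - 2, lt_trans h i.isLt⟩ else 0))) s.domain ∧ y = Literature.NumberTheory.Transcendental.KZ.of s}) : ∀ (ℓ : ℕ), ℓ ≤ 2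 → ∀ y ∈ LogRep ℓ, y ∈ Literature.NumberTheory.Transcendental.KZ.relations ⊔ AddSubgroup.closure {x : Literature.NumberTheory.Transcendental.KZ.FormalRep | ∃ (w : ℕ) (ε : Fin w → Bool) (q : ℚ) (s : Literature.NumberTheory.Transcendental.KZ.IntegralRep w), s.domain = {t : Fin w → ℝ | (∀ i, 0 < t i) ∧ (∀ i, t i < 1) ∧ StrictAnti t} ∧ Set.EqOn s.integrand (fun t => (q : ℝ) * ∏ i, if ε i then 1 / (1 - t i) else 1 / t i) s.domain ∧ x = Literature.NumberTheory.Transcendental.KZ.of s} :=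
  Summit.KontsevichZagierPeriods.DihedralNormalForm.TameBVStokes.stub_cellZetaMovesLow LogRep hLogRep

/-- **stub_cellZetaMovesThree** (LANDED p115239 + Aux1–4 p101013/p100424/p101021/p103821, `Theorems/LinRedNormalFormDihedralNormalFormStubCellZetaMovesThree*.lean`; shown as `sorry` in this published copy only because the farm had not yet built that module's olean when the skeleton was published — the lead's `work/DihedralNormalForm.lean` imports it). DIMENSION `ℓ = 3` (`M_{0,6}`) of word surjectivity, EXPLICIT (Brown–Carr–Schneps 2010, §4.4.1): residues along the four facets `s₂ → 0`, `s₀ → 1`, `s₀ = s₁`, `s₁ = s₂` of `{1 > s₀ > s₁ > s₂ > 0}` and at the two corners `s → 0`, `s → (1,1,1)` force an integrable `ℚ`-combination of the 24 Arnold products `∏ 1/(sᵢ − aᵢ)` to lie in the 4-dimensional span of `[0,0,1]` (the `ζ(3)` word), `[0,1,1]` (the `ζ(2,1)` word), `h₁ = [0,1,s₀]` and `h₂ = [1,0,s₀] − [1,0,1]` (`[a₀,a₁,a₂] := 1/((s₀−a₀)(s₁−a₁)(s₂−a₂))`); the order-6 rotation of `(0,t₁,t₂,t₃,1,∞)`,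 `σ(s₀,s₁,s₂) = (1 − s₂, 1 − s₂/s₀, 1 − s₂/s₁)`, a rational bijection of the open simplex with `|det Dσ| = s₂²/(s₀²s₁²)`, is ONE change-of-variables move and satisfies `(h₂∘σ)|J| = h₁`, `(h₁∘σ)|J| = [0,1,1] − [0,0,1]`, `([0,1,1]∘σ)|J| = −[0,0,1]` (`ζ(2,1) = ζ(3)` as one move), `([0,0,1]∘σ)|J| = −h₂ − [0,0,1]`, so every convergent combination is a `ℤ`-combination of the two weight-3 word representations modulo relations (rule 1b splits between integrable pieces). -/
theorem stub_cellZetaMovesThree (LogRep : ℕ → Set Literature.NumberTheory.Transcendental.KZ.FormalRep) (hLogRep : ∀ ℓ, LogRep ℓ = {y : Literature.NumberTheory.Transcendental.KZ.FormalRep | ∃ (q : (Fin ℓ → Fin (ℓ + 2)) → ℚ) (s : Literature.NumberTheory.Transcendental.KZ.IntegralRep ℓ), s.domain = {t : Fin ℓ → ℝ | (∀ i, 0 < t i) ∧ (∀ i, t i < 1) ∧ StrictAnti t} ∧ Set.EqOn s.integrand (fun t => ∑ f : Fin ℓ → Fin (ℓ + 2), (q f : ℝ) * ∏ i : Fin ℓ,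 1 / (t i - (if ((f i : Fin (ℓ + 2)) : ℕ) = 0 then (0:ℝ) else if ((f i : Fin (ℓ + 2)) : ℕ) = 1 then 1 else if h : ((f i : Fin (ℓ + 2)) : ℕ) - 2 < (i : ℕ) then t ⟨((f i : Fin (ℓ + 2)) : ℕ) - 2, lt_trans h i.isLt⟩ else 0))) s.domain ∧ y = Literature.NumberTheory.Transcendental.KZ.of s}) : ∀ y ∈ LogRep 3, y ∈ Literature.NumberTheory.Transcendental.KZ.relations ⊔ AddSubgroup.closure {x : Literature.NumberTheory.Transcendental.KZ.FormalRep | ∃ (w : ℕ) (ε : Fin w → Bool) (q : ℚ) (s : Literature.NumberTheory.Transcendental.KZ.IntegralRep w), s.domain = {t : Fin w → ℝ | (∀ i, 0 < t i) ∧ (∀ i, t i < 1) ∧ StrictAnti t} ∧ Set.EqOn s.integrand (fun t => (q : ℝ) * ∏ i, if ε i then 1 / (1 - t i) else 1 / t i) s.domain ∧ x = Literature.NumberTheory.Transcendental.KZ.of s} := by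
  sorry

/-- **stub_cellZetaMovesVeryHigh** (XL, research-sized — held by the lead). WORD SURJECTIVITY for `ℓ ≥ 4`: every convergent bar-form combination on `Δ_ℓ` is, modulo relations, a `ℤ`-combination of MZV word representations and of products of two such combinations of smaller positive dimensions (Brown–Carr–Schneps 2010: insertion basis Thm 4.9, the relation families of Def. 2.27/2.28 — dihedral relabellings of the cell (rule 2), product maps along forgetful morphisms = shuffle dissections (rules 1a + 2), linear polygon identities (rule 1b) — machine-verified for `n ≤ 9`, §4.4; the general case is of the strength of the surjectivity half of BCS Conjecture 1.4). -/
theorem stub_cellZetaMovesVeryHigh (LogRep : ℕ → Set Literature.NumberTheory.Transcendental.KZ.FormalRep) (hLogRep : ∀ ℓ, LogRep ℓ = {y : Literature.NumberTheory.Transcendental.KZ.FormalRep | ∃ (q : (Fin ℓ → Fin (ℓ + 2)) → ℚ) (s : Literature.NumberTheory.Transcendental.KZ.IntegralRep ℓ), s.domain = {t : Fin ℓ → ℝ | (∀ i, 0 < t i) ∧ (∀ i, t i < 1) ∧ StrictAnti t} ∧ Set.EqOn s.integrand (fun t => ∑ f : Fin ℓ → Fin (ℓ + 2), (q f : ℝ)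 * ∏ i : Fin ℓ, 1 / (t i - (if ((f i : Fin (ℓ + 2)) : ℕ) = 0 then (0:ℝ) else if ((f i : Fin (ℓ + 2)) : ℕ) = 1 then 1 else if h : ((f i : Fin (ℓ + 2)) : ℕ) - 2 < (i : ℕ) then t ⟨((f i : Fin (ℓ + 2)) : ℕ) - 2, lt_trans h i.isLt⟩ else 0))) s.domain ∧ y = Literature.NumberTheory.Transcendental.KZ.of s}) : ∀ (ℓ : ℕ), ∀ y ∈ LogRep (ℓ + 4), y ∈ Literature.NumberTheory.Transcendental.KZ.relations ⊔ AddSubgroup.closure ({x : Literature.NumberTheory.Transcendental.KZ.FormalRep | ∃ (w : ℕ) (ε : Fin w → Bool) (q : ℚ) (s : Literature.NumberTheory.Transcendental.KZ.IntegralRep w), s.domain = {t : Fin w → ℝ | (∀ i, 0 < t i) ∧ (∀ i, t i < 1) ∧ StrictAnti t} ∧ Set.EqOn s.integrand (fun t => (q : ℝ) * ∏ i, if ε i then 1 / (1 - t i) else 1 / t i) s.domain ∧ x = Literature.NumberTheory.Transcendental.KZ.of s} ∪ {y : Literature.NumberTheory.Transcendental.KZ.FormalRep | ∃ (a b : ℕ)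 (s₁ : Literature.NumberTheory.Transcendental.KZ.IntegralRep a) (s₂ : Literature.NumberTheory.Transcendental.KZ.IntegralRep b), a + b = ℓ + 4 ∧ 0 < a ∧ 0 < b ∧ Literature.NumberTheory.Transcendental.KZ.of s₁ ∈ LogRep a ∧ Literature.NumberTheory.Transcendental.KZ.of s₂ ∈ LogRep b ∧ y = Literature.NumberTheory.Transcendental.KZ.of (s₁.prod s₂)}) := by
  sorry

/-- **stub_productClosure** (LANDED p84815, `Theorems/LinRedNormalFormDihedralNormalFormStubProductClosure.lean`). PRODUCTS OF NORMAL FORMS ARE NORMAL FORMS: `relations ⊔ closure WordRep` is closed under the product of representations — `KZ.of (s₁.prod s₂) = KZ.of s₁ * KZ.of s₂` (`KZ.of_mul_of`), `relations` is a two-sided ideal (`KZ.mul_mem_relations_left_holds`, `KZ.mul_mem_relations_right_holds`), and a product of two word representations is a sum of word representations by the shuffle dissection of `Δ_a × Δ_b` (rules 1a + 2; `ShuffleProductInKZ` of Theorems/MzvKernelInKZTwoPosetsShuffleProduct.lean; empty and non-admissible words: constants resp. zero integrands). -/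
theorem stub_productClosure : ∀ (a b : ℕ) (s₁ : Literature.NumberTheory.Transcendental.KZ.IntegralRep a) (s₂ : Literature.NumberTheory.Transcendental.KZ.IntegralRep b), Literature.NumberTheory.Transcendental.KZ.of s₁ ∈ Literature.NumberTheory.Transcendental.KZ.relations ⊔ AddSubgroup.closure {x : Literature.NumberTheory.Transcendental.KZ.FormalRep | ∃ (w : ℕ) (ε : Fin w → Bool) (q : ℚ) (s : Literature.NumberTheory.Transcendental.KZ.IntegralRep w), s.domain = {t : Fin w → ℝ | (∀ i, 0 < t i) ∧ (∀ i, t i < 1) ∧ StrictAnti t} ∧ Set.EqOn s.integrand (fun t => (q : ℝ) * ∏ i, if ε i then 1 / (1 - t i) else 1 / t i) s.domain ∧ x = Literature.NumberTheory.Transcendental.KZ.of s} → Literature.NumberTheory.Transcendental.KZ.of s₂ ∈ Literature.NumberTheory.Transcendental.KZ.relations ⊔ AddSubgroup.closure {x : Literature.NumberTheory.Transcendental.KZ.FormalRep | ∃ (w : ℕ) (ε : Fin w → Bool) (q : ℚ) (s : Literature.NumberTheory.Transcendental.KZ.IntegralRep w), s.domain = {t : Fin w → ℝ | (∀ i, 0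 < t i) ∧ (∀ i, t i < 1) ∧ StrictAnti t} ∧ Set.EqOn s.integrand (fun t => (q : ℝ) * ∏ i, if ε i then 1 / (1 - t i) else 1 / t i) s.domain ∧ x = Literature.NumberTheory.Transcendental.KZ.of s} → Literature.NumberTheory.Transcendental.KZ.of (s₁.prod s₂) ∈ Literature.NumberTheory.Transcendental.KZ.relations ⊔ AddSubgroup.closure {x : Literature.NumberTheory.Transcendental.KZ.FormalRep | ∃ (w : ℕ) (ε : Fin w → Bool) (q : ℚ) (s : Literature.NumberTheory.Transcendental.KZ.IntegralRep w), s.domain = {t : Fin w → ℝ | (∀ i, 0 < t i) ∧ (∀ i, t i < 1) ∧ StrictAnti t} ∧ Set.EqOn s.integrand (fun t => (q : ℝ) * ∏ i, if ε i then 1 / (1 - t i) else 1 / t i) s.domain ∧ x = Literature.NumberTheory.Transcendental.KZ.of s} :=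
  Summit.KontsevichZagierPeriods.DihedralNormalForm.TameBVStokes.stub_productClosure

/-! ## Composition (sorry-free) -/

/-- The working subgroup: relations plus the `ℤ`-span of the MZV word representations. -/
abbrev RW : AddSubgroup KZ.FormalRep := KZ.relations ⊔ AddSubgroup.closure WordRep

theorem relations_le_RW : KZ.relations ≤ RW := le_sup_left

theorem wordRep_subset_RW : WordRep ⊆ (RW : Set KZ.FormalRep) := fun _ hx =>
  (le_sup_right : AddSubgroup.closure WordRep ≤ RW) (AddSubgroup.subset_closure hx)

/-- The first lineage's atoms are cubical representations (cast the exponents to `ℤ`). -/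
theorem atomN_subset_cubRep (k : ℕ) : AtomN k ⊆ CubRep k := by
  rintro z ⟨q, a, e, s, hdom, hint, rfl⟩
  refine ⟨q, fun i => (a i : ℤ), e, s, hdom, ?_, rfl⟩
  intro x hx
  rw [hint hx]
  simp only [zpow_natCast]

/-- Dimension zero: a cubical representation of dimension `0` is a word representation (the
empty word: both domains are the one-point space, both integrands the constant `q`). -/
theorem cubRep_zero_subset_wordRep : CubRep 0 ⊆ WordRep := by
  rintro y ⟨q, a, e, s, hdom, hint, rfl⟩
  refine ⟨0, Fin.elim0, q, s, ?_, ?_, rfl⟩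
  · rw [hdom]
    ext t
    simp only [Set.mem_setOf_eq, IsEmpty.forall_iff, true_and]
    exact ⟨fun _ => fun i => i.elim0, fun _ => trivial⟩
  · intro t ht
    rw [hint ht]
    simp

/-- The product generators of `stub_cellZetaMoves` lie in `RW` once the lower `LogRep` do. -/
theorem prod_mem_RW {ℓ : ℕ} (ih : ∀ d < ℓ, LogRep d ⊆ (RW : Set KZ.FormalRep)) :
    {y : Literature.NumberTheory.Transcendental.KZ.FormalRep | ∃ (a b : ℕ) (s₁ : Literature.NumberTheory.Transcendental.KZ.IntegralRep a) (s₂ : Literature.NumberTheory.Transcendental.KZ.IntegralRep b), a + b = ℓ ∧ 0 < a ∧ 0 < b ∧ Literature.NumberTheory.Transcendental.KZ.of s₁ ∈ LogRep a ∧ Literature.NumberTheory.Transcendental.KZ.of s₂ ∈ LogRep b ∧ y = Literature.NumberTheory.Transcendental.KZ.of (s₁.prod s₂)} ⊆ (RW : Set KZ.FormalRep) := by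
  rintro y ⟨a, b, s₁, s₂, hab, ha, hb, h₁, h₂, rfl⟩
  have ha' : a < ℓ := by omega
  have hb' : b < ℓ := by omega
  exact stub_productClosure a b s₁ s₂ (ih a ha' h₁) (ih b hb' h₂)

/-- The main induction: every `LogRep ℓ` and every `CubRep ℓ` lies in `RW`. -/
theorem logRep_cubRep_subset_RW : ∀ ℓ : ℕ, LogRep ℓ ⊆ (RW : Set KZ.FormalRep) ∧ CubRep ℓ ⊆ (RW : Set KZ.FormalRep) := by
  intro ℓ
  induction ℓ using Nat.strong_induction_on with
  | _ ℓ ih =>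
    -- the log forms of dimension `ℓ`
    have hLog : LogRep ℓ ⊆ (RW : Set KZ.FormalRep) := by
      intro y hy
      rcases Nat.lt_or_ge 2 ℓ with hℓ | hℓ
      swap
      · exact stub_cellZetaMovesLow LogRep (fun _ => rfl) ℓ hℓ y hy
      · rcases Nat.lt_or_ge 3 ℓ with hℓ3 | hℓ3
        swap
        · obtain rfl : ℓ = 3 := le_antisymm hℓ3 hℓ
          exact stub_cellZetaMovesThree LogRep (fun _ => rfl) y hy
        obtain ⟨ℓ', rfl⟩ : ∃ ℓ', ℓ = ℓ' + 4 := ⟨ℓ - 4, by omega⟩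
        have h := stub_cellZetaMovesVeryHigh LogRep (fun _ => rfl) ℓ' y hy
        have hle : AddSubgroup.closure (WordRep ∪ {y : Literature.NumberTheory.Transcendental.KZ.FormalRep | ∃ (a b : ℕ) (s₁ : Literature.NumberTheory.Transcendental.KZ.IntegralRep a) (s₂ : Literature.NumberTheory.Transcendental.KZ.IntegralRep b), a + b = ℓ' + 4 ∧ 0 < a ∧ 0 < b ∧ Literature.NumberTheory.Transcendental.KZ.of s₁ ∈ LogRep a ∧ Literature.NumberTheory.Transcendental.KZ.of s₂ ∈ LogRep b ∧ y = Literature.NumberTheory.Transcendental.KZ.of (s₁.prod s₂)}) ≤ RW := by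
          rw [AddSubgroup.closure_le]
          exact Set.union_subset wordRep_subset_RW (prod_mem_RW fun d hd => (ih d hd).1)
        exact (sup_le relations_le_RW hle) h
    refine ⟨hLog, ?_⟩
    -- the cubical representations of dimension `ℓ`
    match ℓ, ih, hLog with
    | 0, _, _ => exact cubRep_zero_subset_wordRep.trans wordRep_subset_RW
    | 1, ih, _ =>
      intro y hy
      have h := stub_exactToFacesOne CubRep (fun _ => rfl) y hy
      have hle : AddSubgroup.closure (CubRep 0) ≤ RW := by
        rw [AddSubgroup.closure_le]
        exact (ih 0 Nat.one_pos).2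
      exact (sup_le relations_le_RW hle) h
    | 2, ih, hLog =>
      intro y hy
      have h := stub_exactToFacesTwo CubRep (fun _ => rfl) LogRep (fun _ => rfl)
        (stub_boundedStokesMove stub_bvStokes) y hy
      have hle : AddSubgroup.closure (LogRep 2 ∪ CubRep 1) ≤ RW := by
        rw [AddSubgroup.closure_le]
        exact Set.union_subset hLog (ih 1 (by norm_num)).2
      exact (sup_le relations_le_RW hle) h
    | ℓ' + 3, ih, hLog =>
      intro y hy
      have h := stub_exactToFacesHigh CubRep (fun _ => rfl) LogRep (fun _ => rfl)
        (stub_boundedStokesMove stub_bvStokes) ℓ' y hy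
      have hle : AddSubgroup.closure (LogRep (ℓ' + 3) ∪ CubRep (ℓ' + 2)) ≤ RW := by
        rw [AddSubgroup.closure_le]
        exact Set.union_subset hLog (ih (ℓ' + 2) (Nat.lt_succ_self _)).2
      exact (sup_le relations_le_RW hle) h

/-- **The crux from the stubs.** -/
theorem DihedralNormalForm_of : DihedralNormalForm := by
  intro k r p a b c hdom hint
  obtain ⟨m₀, hm₀, hrel⟩ := stub_atomReduction k r p a b c hdom hint
  -- the atoms of the entrance stub lie in `RW`
  have hle : AddSubgroup.closure (AtomN k) ≤ RW := by
    rw [AddSubgroup.closure_le]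
    exact (atomN_subset_cubRep k).trans (logRep_cubRep_subset_RW k).2
  obtain ⟨y, hy, z, hz, hyz⟩ := AddSubgroup.mem_sup.1 (hle hm₀)
  refine ⟨z, hz, ?_⟩
  have : Literature.NumberTheory.Transcendental.KZ.of r - z = (Literature.NumberTheory.Transcendental.KZ.of r - m₀) + y := by
    rw [← hyz]; abel
  rw [this]
  exact add_mem hrel hy

end Summit.KontsevichZagierPeriods.KontsevichZagierPeriods.Cruxes.DihedralNormalForm.TameBVStokes
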